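import Summits.HodgeConjecture.HodgeConjecture.Theorems.R90S6ShellSphereDictU2                -- ★ A1-H FILE 1 (this seat): `mem_doubleCoset_pow_iff_dist_eq_two`, `latt_coe_eq_latt_coe_iff`, `dist_latticeTreeIso_latticeTreeIso_mul_eq`, `typeFun_ne_of_adj_two`, …
import Summits.HodgeConjecture.HodgeConjecture.Theorems.R90S6EllipticOrbitalDisplacementCount   -- ★ A1 p863730: §1 `orbitalIntegral_indicator_doubleCoset_eq_mul_ncard_orbitShell` (any group); brings ★ (J1), ★ W8-f closed forms, ★ `isOpen_unitaryInt`
import HarnessLib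

/-!
# R90 · S6 «Ch. 14.1–14.5 stable trace formula» — CARD A1-H, FILE 2 (rows E1.3.5.2.5 ∕ E1.3.7.1): ELLIPTIC ORBITAL INTEGRALS OF THE HECKE BASIS OF `U(2)_w ≅ U(1,1)` AS
# DISPLACEMENT COUNTS ON THE `(q_v+1)`-REGULAR BRUHAT–TITS TREE — THE (J2)-TWIN AND THE ASSEMBLY (`Theorems/R90S6EllipticOrbitalDisplacementU2.lean`)

Dealer R90-C14-plan (g2), CARD A1-H 2026-09-05T00:48:01Z, ruling 00:50:12Z, junction census 00:56:18Z.  Setting and letters of FILE 1 ★ `R90S6ShellSphereDictU2`: `K : Type` with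
`Valued K ℤᵐ⁰` + `ValuativeRel K` compatible, `hd : UnramifiedLocalConjDatum σ ϖ`, `H₂ = (StdForm.antidiagonal 2).over K`, `U₂ = unitaryGroupOfForm σ H₂`, `K₀ = unitaryInt σ H₂`,
`t` p03's torus binder (`ht`), `φ′_k = 1_{K₀ tᵏ K₀} = (DoubleCoset.doubleCoset (t ^ k) K₀ K₀).indicator 1`, `X₂ = latticeTree σ ϖ H₂`, `U₂` acting by `latticeTreeIso`; `γ ∈ U₂` with COMPACT
centraliser carrying the Haar measure `ρ` of mass one, `ν` a Haar measure on `U₂`, `O_γ = orbitalIntegral γ · (quotientMeasure C ρ ν)`.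

* §4 THE RANK-ONE (J2) **`ncard_quotient_shell_eq_ncard_selfDual_displaced_two`**: `#{q ∈ U₂⧸K₀ : (q.out⁻¹γq.out)K₀ ∈ K₀·tᵏK₀} = #{x self-dual : d(x, γ·x) = 2k}` (bijection
  `q ↦ q.out·𝒪²`: injective ★ (T3) `mk_eq_mk_iff_latt_eq`, onto by the transitivity binder `hA`, shell ↔ displacement by FILE 1 §3), the finiteness transfer
  `finite_quotient_shell_of_finite_displaced_two`, and THE ASSEMBLY **`orbitalIntegral_doubleCosetShell_eq_mul_ncard_displaced_two`**:
  `O_γ^{ν∕ρ}(1_{K₀ tᵏ K₀}) = ν(K₀) · #{x self-dual : d(x, γ·x) = 2k}` (★ A1 §1 ∘ §4), + the ELLIPTIC edition `…_of_finite_fixedPoints_two` (finiteness discharged).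
* §5 CLOSED FORM mod the first shell (★ W8-f, typed; `c` a type function `c v = 0 ↔ v` self-dual, valencies `q (c v) + 1` at moved vertices — both `q_v` here):
  **`orbitalIntegral_doubleCosetShell_odd_eq_two`** `O_γ(φ′_{2n+1}) = ν(K₀)(q₁q₀)ⁿ·#{d = 2, c = 0}`, **`orbitalIntegral_doubleCosetShell_even_eq_two`** `O_γ(φ′_{2n+2}) = ν(K₀)q₁(q₀q₁)ⁿ·#{d = 2, c = 1}`
  (with `q₀ = q₁ = q_v`: `q_v^{k−1}` times the hyperspecial resp. `ϖ`-modular FIRST displacement shell — the parity split is real: the self-dual vertices displaced by `2k` sit at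
  distance `k` from `Fix γ`, and types alternate along the tree).

Transitivity of `U₂` on the self-dual lattices is the BINDER `hA` in ★ (A′)'s exact shape (`HermitianLatticeTreeFixedDictionary`), discharged at a local field by ★
`forall_isSelfDualLattice_exists_latt_eq_of_isUnit_sub`; local finiteness `hloc`, a fixed vertex `hu` and `Fix γ` finite `hfix` as in A1; measure binders as in A1 (centraliser measure `ρ`).
Cell `hodgecm-mathlib`, crux H413 (`stmt-HodgeConjecture-24833`), route of record `HCCMUnconditional`; programme R90-TF (brief `director/R90-BRIEF.v2.md` 1f40d54518340a35),
section S6 (base `R90-C14`), seat R90-C14-p01 (g2).  Lane `--kind proof --supports stmt-HodgeConjecture-24833 --as helper`; THEOREMS ONLY (no definition, no instance, no notation,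
no named fact, no kit, no `sorry`).
HONEST LABEL: tree∕coset bookkeeping for the H-side engine E1.3.5.2.5 — count-neutral until E1.3.5.2.6 ∕ E1.3.7.1 consume it; proves no printed global statement, discharges no
citation; HC_CM is proved only modulo the 7 printed citations (2 remaining named inputs: hLiu418 = stmt-HodgeConjecture-24832, h413 = stmt-HodgeConjecture-24833) until rung 0 closes.

## References
* [Rogawski1990] J. D. Rogawski, *Automorphic Representations of Unitary Groups in Three Variables*, Ann. of Math. Stud. 123 (1990): §4.9 pp. 54–55, §4.11 pp. 59–60.
* [LabesseLanglands1979] J.-P. Labesse, R. P. Langlands, *L-indistinguishability for SL(2)*, Canad. J. Math. 31 (1979): §§2–3.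
* [Serre1980Trees] J.-P. Serre, *Trees* (1980): I.2.3, I.6.4 Prop. 24–25, II.1.1.
* [BruhatTits1972] F. Bruhat, J. Tits, *Groupes réductifs sur un corps local I*, Publ. Math. IHÉS 41 (1972): §10, (4.4.3).
* [Kottwitz1986BaseChangeUnits] R. E. Kottwitz, *Base change for unit elements of Hecke algebras*, Compositio Math. 60 (1986): §1 pp. 240–242.
-/

set_option autoImplicit false
-- the mandated namespace repeats the single-problem summit's segment (`HodgeConjecture.HodgeConjecture`)
set_option linter.dupNamespace false

noncomputable section

open MeasureTheory Measure Topology Set Function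
open scoped ENNReal NNReal Pointwise ValuativeRel Matrix MatrixGroups
open MulAction SimpleGraph Matrix ValuativeRel
open Literature.MeasureTheory.Group Literature.NumberTheory.Automorphic
open Literature.NumberTheory.Automorphic.HermitianLatticeTree
open Literature.Combinatorics.SimpleGraph

namespace Summit.HodgeConjecture.HodgeConjecture.R90.S6

section Two

variable {K : Type} [Field K] [Valued K (WithZero (Multiplicative ℤ))] [ValuativeRel K]
  [(Valued.v : Valuation K (WithZero (Multiplicative ℤ))).Compatible] {σ : K →+* K} {ϖ : K}

/-! ## §4 The rank-one (J2), the finiteness transfers and THE ASSEMBLY -/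

/-- **(J2) rank one — cosets in the shell ↔ displaced hyperspecial vertices**: for `γ ∈ U₂` and `k ∈ ℕ`,
`#{q ∈ U₂ ⧸ K₀ : (q.out⁻¹ γ q.out) K₀ ∈ K₀ · tᵏK₀} = #{x ∈ X₂ : x self-dual ∧ d(x, γ·x) = 2k}` (`Set.ncard`, both sides infinite together), via `q ↦ q.out · 𝒪²`
(injective by ★ (T3) `mk_eq_mk_iff_latt_eq`, onto the self-dual vertices by the transitivity binder `hA`, shell ↔ displacement by §3).
[cite: Rogawski1990, §4.9 pp. 54–55] [cite: LabesseLanglands1979, §§2–3] [cite: BruhatTits1972, §10] -/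
theorem ncard_quotient_shell_eq_ncard_selfDual_displaced_two (hd : HermitianLattice.UnramifiedLocalConjDatum σ ϖ)
    (t : unitaryGroupOfForm σ ((StdForm.antidiagonal 2).over K))
    (ht : (t : GL (Fin 2) K) = zpowDiagGL (CartanUnique.uniformizer_ne_zero hd.vϖ) ![(1 : ℤ), -1])
    (hA : ∀ M : Submodule 𝒪[K] (Fin 2 → K), IsSelfDualLattice σ ((StdForm.antidiagonal 2).over K) M →
      ∃ u : unitaryGroupOfForm σ ((StdForm.antidiagonal 2).over K), latt (((u : GL (Fin 2) K)) : Matrix (Fin 2) (Fin 2) K) = M)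
    (γ : unitaryGroupOfForm σ ((StdForm.antidiagonal 2).over K)) (k : ℕ) :
    {q : unitaryGroupOfForm σ ((StdForm.antidiagonal 2).over K) ⧸ HermitianLattice.unitaryInt σ ((StdForm.antidiagonal 2).over K) |
        ((q.out⁻¹ * γ * q.out : unitaryGroupOfForm σ ((StdForm.antidiagonal 2).over K)) :
            unitaryGroupOfForm σ ((StdForm.antidiagonal 2).over K) ⧸ HermitianLattice.unitaryInt σ ((StdForm.antidiagonal 2).over K)) ∈
          MulAction.orbit (HermitianLattice.unitaryInt σ ((StdForm.antidiagonal 2).over K))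
            ((t ^ k : unitaryGroupOfForm σ ((StdForm.antidiagonal 2).over K)) :
              unitaryGroupOfForm σ ((StdForm.antidiagonal 2).over K) ⧸ HermitianLattice.unitaryInt σ ((StdForm.antidiagonal 2).over K))}.ncard =
      {x : {M : Submodule 𝒪[K] (Fin 2 → K) // IsSpecialLattice σ ϖ ((StdForm.antidiagonal 2).over K) M} |
        IsSelfDualLattice σ ((StdForm.antidiagonal 2).over K) x.1 ∧
          (latticeTree σ ϖ ((StdForm.antidiagonal 2).over K)).dist x (latticeTreeIso σ ϖ ((StdForm.antidiagonal 2).over K) γ x) = 2 * k}.ncard := by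
  -- the root
  set x₀ : {M : Submodule 𝒪[K] (Fin 2 → K) // IsSpecialLattice σ ϖ ((StdForm.antidiagonal 2).over K) M} :=
    ⟨latt (1 : Matrix (Fin 2) (Fin 2) K), Or.inl (isSelfDualLattice_latt_one σ isUnimodular₂_antidiagonal_two)⟩ with hx₀def
  have hx₀ : x₀.1 = latt (1 : Matrix (Fin 2) (Fin 2) K) := rfl
  -- `u · x₀` has underlying lattice `latt ↑u`
  have hval : ∀ u : unitaryGroupOfForm σ ((StdForm.antidiagonal 2).over K),
      (latticeTreeIso σ ϖ ((StdForm.antidiagonal 2).over K) u x₀).1 = latt (((u : GL (Fin 2) K)) : Matrix (Fin 2) (Fin 2) K) := by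
    intro u
    have h1 : latt (1 : Matrix (Fin 2) (Fin 2) K) =
        latt ((((1 : unitaryGroupOfForm σ ((StdForm.antidiagonal 2).over K)) : GL (Fin 2) K)) : Matrix (Fin 2) (Fin 2) K) := by
      rw [Subgroup.coe_one, Units.val_one]
    change mapGL (u : GL (Fin 2) K) x₀.1 = _
    rw [hx₀, h1, mapGL_coe_latt, mul_one]
  -- the shell condition at `q` ↔ `q.out · x₀` displaced by `2k`
  have key : ∀ u : unitaryGroupOfForm σ ((StdForm.antidiagonal 2).over K),
      ((u⁻¹ * γ * u : unitaryGroupOfForm σ ((StdForm.antidiagonal 2).over K)) :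
            unitaryGroupOfForm σ ((StdForm.antidiagonal 2).over K) ⧸ HermitianLattice.unitaryInt σ ((StdForm.antidiagonal 2).over K)) ∈
          MulAction.orbit (HermitianLattice.unitaryInt σ ((StdForm.antidiagonal 2).over K))
            ((t ^ k : unitaryGroupOfForm σ ((StdForm.antidiagonal 2).over K)) :
              unitaryGroupOfForm σ ((StdForm.antidiagonal 2).over K) ⧸ HermitianLattice.unitaryInt σ ((StdForm.antidiagonal 2).over K)) ↔
        (latticeTree σ ϖ ((StdForm.antidiagonal 2).over K)).dist (latticeTreeIso σ ϖ ((StdForm.antidiagonal 2).over K) u x₀)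
          (latticeTreeIso σ ϖ ((StdForm.antidiagonal 2).over K) γ (latticeTreeIso σ ϖ ((StdForm.antidiagonal 2).over K) u x₀)) = 2 * k := by
    intro u
    rw [dist_latticeTreeIso_latticeTreeIso_mul_eq, ← mem_doubleCoset_iff_mk_mem_orbit, mem_doubleCoset_pow_iff_dist_eq_two hd t ht x₀ hx₀]
  refine Set.ncard_congr (fun q _ => latticeTreeIso σ ϖ ((StdForm.antidiagonal 2).over K) q.out x₀) (fun q hq => ?_) (fun q q' _ _ h => ?_) (fun y hy => ?_)
  · -- INTO
    refine ⟨?_, (key q.out).1 hq⟩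
    change IsSelfDualLattice σ ((StdForm.antidiagonal 2).over K) (mapGL (q.out : GL (Fin 2) K) x₀.1)
    exact isSelfDualLattice_mapGL σ ((StdForm.antidiagonal 2).over K) (q.out : GL (Fin 2) K) q.out.2
      (isSelfDualLattice_latt_one σ isUnimodular₂_antidiagonal_two)
  · -- INJECTIVE
    have h' : latt (((q.out : GL (Fin 2) K)) : Matrix (Fin 2) (Fin 2) K) = latt (((q'.out : GL (Fin 2) K)) : Matrix (Fin 2) (Fin 2) K) := by
      rw [← hval, ← hval, h]
    have h'' := (latt_coe_eq_latt_coe_iff q.out q'.out).1 h'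
    rwa [QuotientGroup.out_eq', QuotientGroup.out_eq'] at h''
  · -- ONTO
    obtain ⟨hy, hdist⟩ := hy
    obtain ⟨u, hu⟩ := hA y.1 hy
    have huy : latticeTreeIso σ ϖ ((StdForm.antidiagonal 2).over K) u x₀ = y := Subtype.ext (by rw [hval, hu])
    have hout : latticeTreeIso σ ϖ ((StdForm.antidiagonal 2).over K)
        ((u : unitaryGroupOfForm σ ((StdForm.antidiagonal 2).over K) ⧸ HermitianLattice.unitaryInt σ ((StdForm.antidiagonal 2).over K)).out) x₀ =
          latticeTreeIso σ ϖ ((StdForm.antidiagonal 2).over K) u x₀ := by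
      apply Subtype.ext
      rw [hval, hval]
      exact (latt_coe_eq_latt_coe_iff _ _).2 (QuotientGroup.out_eq' _)
    refine ⟨(u : unitaryGroupOfForm σ ((StdForm.antidiagonal 2).over K) ⧸ HermitianLattice.unitaryInt σ ((StdForm.antidiagonal 2).over K)), ?_, ?_⟩
    · rw [Set.mem_setOf_eq, key, hout, huy]
      exact hdist
    · rw [hout, huy]

/-- **Finiteness transfer** (rank one): finitely many self-dual vertices displaced by `2k` ⇒ finitely many cosets in the shell (`q ↦ q.out·𝒪²` is injective and maps the shell into
that set). [cite: BruhatTits1972, §10] [cite: Serre1980Trees, II.1.1] -/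
theorem finite_quotient_shell_of_finite_displaced_two (hd : HermitianLattice.UnramifiedLocalConjDatum σ ϖ)
    (t : unitaryGroupOfForm σ ((StdForm.antidiagonal 2).over K))
    (ht : (t : GL (Fin 2) K) = zpowDiagGL (CartanUnique.uniformizer_ne_zero hd.vϖ) ![(1 : ℤ), -1])
    (γ : unitaryGroupOfForm σ ((StdForm.antidiagonal 2).over K)) (k : ℕ)
    (hfin : {x : {M : Submodule 𝒪[K] (Fin 2 → K) // IsSpecialLattice σ ϖ ((StdForm.antidiagonal 2).over K) M} |
        IsSelfDualLattice σ ((StdForm.antidiagonal 2).over K) x.1 ∧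
          (latticeTree σ ϖ ((StdForm.antidiagonal 2).over K)).dist x (latticeTreeIso σ ϖ ((StdForm.antidiagonal 2).over K) γ x) = 2 * k}.Finite) :
    {q : unitaryGroupOfForm σ ((StdForm.antidiagonal 2).over K) ⧸ HermitianLattice.unitaryInt σ ((StdForm.antidiagonal 2).over K) |
        ((q.out⁻¹ * γ * q.out : unitaryGroupOfForm σ ((StdForm.antidiagonal 2).over K)) :
            unitaryGroupOfForm σ ((StdForm.antidiagonal 2).over K) ⧸ HermitianLattice.unitaryInt σ ((StdForm.antidiagonal 2).over K)) ∈
          MulAction.orbit (HermitianLattice.unitaryInt σ ((StdForm.antidiagonal 2).over K))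
            ((t ^ k : unitaryGroupOfForm σ ((StdForm.antidiagonal 2).over K)) :
              unitaryGroupOfForm σ ((StdForm.antidiagonal 2).over K) ⧸ HermitianLattice.unitaryInt σ ((StdForm.antidiagonal 2).over K))}.Finite := by
  set x₀ : {M : Submodule 𝒪[K] (Fin 2 → K) // IsSpecialLattice σ ϖ ((StdForm.antidiagonal 2).over K) M} :=
    ⟨latt (1 : Matrix (Fin 2) (Fin 2) K), Or.inl (isSelfDualLattice_latt_one σ isUnimodular₂_antidiagonal_two)⟩ with hx₀def
  have hx₀ : x₀.1 = latt (1 : Matrix (Fin 2) (Fin 2) K) := rfl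
  have hval : ∀ u : unitaryGroupOfForm σ ((StdForm.antidiagonal 2).over K),
      (latticeTreeIso σ ϖ ((StdForm.antidiagonal 2).over K) u x₀).1 = latt (((u : GL (Fin 2) K)) : Matrix (Fin 2) (Fin 2) K) := by
    intro u
    have h1 : latt (1 : Matrix (Fin 2) (Fin 2) K) =
        latt ((((1 : unitaryGroupOfForm σ ((StdForm.antidiagonal 2).over K)) : GL (Fin 2) K)) : Matrix (Fin 2) (Fin 2) K) := by
      rw [Subgroup.coe_one, Units.val_one]
    change mapGL (u : GL (Fin 2) K) x₀.1 = _
    rw [hx₀, h1, mapGL_coe_latt, mul_one]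
  have hinj : Function.Injective
      (fun q : unitaryGroupOfForm σ ((StdForm.antidiagonal 2).over K) ⧸ HermitianLattice.unitaryInt σ ((StdForm.antidiagonal 2).over K) =>
        latticeTreeIso σ ϖ ((StdForm.antidiagonal 2).over K) q.out x₀) := by
    intro q q' h
    have h' : latt (((q.out : GL (Fin 2) K)) : Matrix (Fin 2) (Fin 2) K) = latt (((q'.out : GL (Fin 2) K)) : Matrix (Fin 2) (Fin 2) K) := by
      rw [← hval, ← hval]; exact congrArg Subtype.val h
    have h'' := (latt_coe_eq_latt_coe_iff q.out q'.out).1 h'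
    rwa [QuotientGroup.out_eq', QuotientGroup.out_eq'] at h''
  refine (hfin.preimage hinj.injOn).subset fun q hq => ?_
  refine ⟨?_, ?_⟩
  · change IsSelfDualLattice σ ((StdForm.antidiagonal 2).over K) (mapGL (q.out : GL (Fin 2) K) x₀.1)
    exact isSelfDualLattice_mapGL σ ((StdForm.antidiagonal 2).over K) (q.out : GL (Fin 2) K) q.out.2
      (isSelfDualLattice_latt_one σ isUnimodular₂_antidiagonal_two)
  · show (latticeTree σ ϖ ((StdForm.antidiagonal 2).over K)).dist (latticeTreeIso σ ϖ ((StdForm.antidiagonal 2).over K) q.out x₀)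
      (latticeTreeIso σ ϖ ((StdForm.antidiagonal 2).over K) γ (latticeTreeIso σ ϖ ((StdForm.antidiagonal 2).over K) q.out x₀)) = 2 * k
    rw [dist_latticeTreeIso_latticeTreeIso_mul_eq, ← mem_doubleCoset_pow_iff_dist_eq_two hd t ht x₀ hx₀, mem_doubleCoset_iff_mk_mem_orbit]
    exact hq

omit [Valued K (WithZero (Multiplicative ℤ))] [(Valued.v : Valuation K (WithZero (Multiplicative ℤ))).Compatible] in
/-- Bookkeeping: with a type function `c`, the displaced self-dual set is the displaced set of type `0`. [cite: BruhatTits1972, §10] -/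
theorem setOf_selfDual_displaced_eq_setOf_displaced_type_zero_two (γ : unitaryGroupOfForm σ ((StdForm.antidiagonal 2).over K))
    (c : {M : Submodule 𝒪[K] (Fin 2 → K) // IsSpecialLattice σ ϖ ((StdForm.antidiagonal 2).over K) M} → Fin 2)
    (hc0 : ∀ v, c v = 0 ↔ IsSelfDualLattice σ ((StdForm.antidiagonal 2).over K) v.1) (m : ℕ) :
    {x : {M : Submodule 𝒪[K] (Fin 2 → K) // IsSpecialLattice σ ϖ ((StdForm.antidiagonal 2).over K) M} |
        IsSelfDualLattice σ ((StdForm.antidiagonal 2).over K) x.1 ∧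
          (latticeTree σ ϖ ((StdForm.antidiagonal 2).over K)).dist x (latticeTreeIso σ ϖ ((StdForm.antidiagonal 2).over K) γ x) = m} =
      {x | (latticeTree σ ϖ ((StdForm.antidiagonal 2).over K)).dist x (latticeTreeIso σ ϖ ((StdForm.antidiagonal 2).over K) γ x) = m ∧ c x = 0} := by
  ext x
  simp only [Set.mem_setOf_eq, hc0]
  exact and_comm

variable (hd : HermitianLattice.UnramifiedLocalConjDatum σ ϖ)
  (t : unitaryGroupOfForm σ ((StdForm.antidiagonal 2).over K))
  (ht : (t : GL (Fin 2) K) = zpowDiagGL (CartanUnique.uniformizer_ne_zero hd.vϖ) ![(1 : ℤ), -1])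
  (hA : ∀ M : Submodule 𝒪[K] (Fin 2 → K), IsSelfDualLattice σ ((StdForm.antidiagonal 2).over K) M →
    ∃ u : unitaryGroupOfForm σ ((StdForm.antidiagonal 2).over K), latt (((u : GL (Fin 2) K)) : Matrix (Fin 2) (Fin 2) K) = M)
  [LocallyCompactSpace (unitaryGroupOfForm σ ((StdForm.antidiagonal 2).over K))]
  [SecondCountableTopology (unitaryGroupOfForm σ ((StdForm.antidiagonal 2).over K))]
  [MeasurableSpace (unitaryGroupOfForm σ ((StdForm.antidiagonal 2).over K))] [BorelSpace (unitaryGroupOfForm σ ((StdForm.antidiagonal 2).over K))]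
  (γ : unitaryGroupOfForm σ ((StdForm.antidiagonal 2).over K))
  [MeasurableSpace (unitaryGroupOfForm σ ((StdForm.antidiagonal 2).over K) ⧸
    Subgroup.centralizer ({γ} : Set (unitaryGroupOfForm σ ((StdForm.antidiagonal 2).over K))))]
  [BorelSpace (unitaryGroupOfForm σ ((StdForm.antidiagonal 2).over K) ⧸
    Subgroup.centralizer ({γ} : Set (unitaryGroupOfForm σ ((StdForm.antidiagonal 2).over K))))]
  [hC : IsClosed ((Subgroup.centralizer ({γ} : Set (unitaryGroupOfForm σ ((StdForm.antidiagonal 2).over K))) :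
    Subgroup (unitaryGroupOfForm σ ((StdForm.antidiagonal 2).over K))) : Set (unitaryGroupOfForm σ ((StdForm.antidiagonal 2).over K)))]
  (ρ : Measure (Subgroup.centralizer ({γ} : Set (unitaryGroupOfForm σ ((StdForm.antidiagonal 2).over K)))))
  [ρ.IsMulLeftInvariant] [IsFiniteMeasureOnCompacts ρ] [ρ.IsOpenPosMeasure] [ρ.IsInvInvariant] [SFinite ρ]
  (ν : Measure (unitaryGroupOfForm σ ((StdForm.antidiagonal 2).over K))) [IsHaarMeasure ν] [ν.IsMulRightInvariant]
  [CompactSpace (Subgroup.centralizer ({γ} : Set (unitaryGroupOfForm σ ((StdForm.antidiagonal 2).over K))))]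
  (hρ : ρ Set.univ = 1)
include ht hA hρ

/-- **CARD A1-H — THE ELLIPTIC ORBITAL INTEGRAL OF `φ′_k = 1_{K₀ tᵏ K₀}` ON `U(2)_w ≅ U(1,1)` IS A DISPLACEMENT COUNT**: for `γ ∈ U₂` with COMPACT centraliser (Haar measure `ρ`
of mass one), `ν` a Haar measure on `U₂`, `t` the split torus generator (p03's binder) and `k ∈ ℕ`, provided finitely many self-dual vertices are displaced by `2k`,
`O_γ^{ν∕ρ}(1_{K₀ tᵏ K₀}) = ν(K₀) · #{x ∈ X₂ : x self-dual ∧ d(x, γ·x) = 2k}` — ★ A1 §1 (generic shell count, `K₀` open ★ `isOpen_unitaryInt`) ∘ §4 (J2)-twin.  The `U(1,1)_w`-factor of the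
H-side `Φ^{st}(γ_H, ξ̂_H φ_m)` read on the `(q_v+1)`-regular tree. [cite: Rogawski1990, §4.9 pp. 54–55] [cite: Rogawski1990, §4.11 pp. 59–60] [cite: LabesseLanglands1979, §§2–3] -/
theorem orbitalIntegral_doubleCosetShell_eq_mul_ncard_displaced_two (k : ℕ)
    (hfin : {x : {M : Submodule 𝒪[K] (Fin 2 → K) // IsSpecialLattice σ ϖ ((StdForm.antidiagonal 2).over K) M} |
        IsSelfDualLattice σ ((StdForm.antidiagonal 2).over K) x.1 ∧
          (latticeTree σ ϖ ((StdForm.antidiagonal 2).over K)).dist x (latticeTreeIso σ ϖ ((StdForm.antidiagonal 2).over K) γ x) = 2 * k}.Finite) :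
    orbitalIntegral γ
        ((DoubleCoset.doubleCoset (t ^ k) (HermitianLattice.unitaryInt σ ((StdForm.antidiagonal 2).over K) : Set _)
            (HermitianLattice.unitaryInt σ ((StdForm.antidiagonal 2).over K))).indicator
          (1 : unitaryGroupOfForm σ ((StdForm.antidiagonal 2).over K) → ℝ))
        (quotientMeasure (Subgroup.centralizer ({γ} : Set (unitaryGroupOfForm σ ((StdForm.antidiagonal 2).over K)))) ρ hC ν) =
      (ν (HermitianLattice.unitaryInt σ ((StdForm.antidiagonal 2).over K))).toReal *
        ({x : {M : Submodule 𝒪[K] (Fin 2 → K) // IsSpecialLattice σ ϖ ((StdForm.antidiagonal 2).over K) M} |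
            IsSelfDualLattice σ ((StdForm.antidiagonal 2).over K) x.1 ∧
              (latticeTree σ ϖ ((StdForm.antidiagonal 2).over K)).dist x
                (latticeTreeIso σ ϖ ((StdForm.antidiagonal 2).over K) γ x) = 2 * k}.ncard : ℝ) := by
  rw [orbitalIntegral_indicator_doubleCoset_eq_mul_ncard_orbitShell (HermitianLattice.unitaryInt σ ((StdForm.antidiagonal 2).over K)) (t ^ k) γ ρ ν
      (HermitianLattice.isOpen_unitaryInt σ _) hρ (finite_quotient_shell_of_finite_displaced_two hd t ht γ k hfin),
    ncard_quotient_shell_eq_ncard_selfDual_displaced_two hd t ht hA γ k]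

/-- **CARD A1-H, ELLIPTIC EDITION (finiteness discharged)**: if `γ` (compact centraliser, mass-one `ρ`) fixes a vertex `u`, has finite fixed set, and the tree is locally finite (`hloc`),
then for EVERY `k`, `O_γ^{ν∕ρ}(1_{K₀ tᵏ K₀}) = ν(K₀) · #{x self-dual : d(x, γ·x) = 2k}`. [cite: Rogawski1990, §4.9 pp. 54–55] [cite: Serre1980Trees, I.6.4 Prop. 24] [cite: LabesseLanglands1979, §§2–3] -/
theorem orbitalIntegral_doubleCosetShell_eq_mul_ncard_displaced_of_finite_fixedPoints_two
    (hloc : ∀ v, ((latticeTree σ ϖ ((StdForm.antidiagonal 2).over K)).neighborSet v).Finite)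
    {u : {M : Submodule 𝒪[K] (Fin 2 → K) // IsSpecialLattice σ ϖ ((StdForm.antidiagonal 2).over K) M}}
    (hu : latticeTreeIso σ ϖ ((StdForm.antidiagonal 2).over K) γ u = u)
    (hfix : {v | latticeTreeIso σ ϖ ((StdForm.antidiagonal 2).over K) γ v = v}.Finite) (k : ℕ) :
    orbitalIntegral γ
        ((DoubleCoset.doubleCoset (t ^ k) (HermitianLattice.unitaryInt σ ((StdForm.antidiagonal 2).over K) : Set _)
            (HermitianLattice.unitaryInt σ ((StdForm.antidiagonal 2).over K))).indicator
          (1 : unitaryGroupOfForm σ ((StdForm.antidiagonal 2).over K) → ℝ))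
        (quotientMeasure (Subgroup.centralizer ({γ} : Set (unitaryGroupOfForm σ ((StdForm.antidiagonal 2).over K)))) ρ hC ν) =
      (ν (HermitianLattice.unitaryInt σ ((StdForm.antidiagonal 2).over K))).toReal *
        ({x : {M : Submodule 𝒪[K] (Fin 2 → K) // IsSpecialLattice σ ϖ ((StdForm.antidiagonal 2).over K) M} |
            IsSelfDualLattice σ ((StdForm.antidiagonal 2).over K) x.1 ∧
              (latticeTree σ ϖ ((StdForm.antidiagonal 2).over K)).dist x
                (latticeTreeIso σ ϖ ((StdForm.antidiagonal 2).over K) γ x) = 2 * k}.ncard : ℝ) := by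
  haveI := isDiscreteValuationRing_integer_of_compatible hd.vϖ
  exact orbitalIntegral_doubleCosetShell_eq_mul_ncard_displaced_two hd t ht hA γ ρ ν hρ k
    (finite_selfDual_displaced_of_finite_fixedPoints_two
      (isTree_latticeTree σ (valuation_map_eq_of_datum hd) (isUniformizingElement_of_v_eq hd.vϖ) isUnimodular₂_antidiagonal_two) γ hloc hu hfix k)

/-! ## §5 Closed form modulo the first displacement shell (★ W8-f, typed) -/

/-- **CLOSED FORM, ODD INDEX (rank one)**: `γ` with compact centraliser (mass-one `ρ`) fixing a vertex `u`, finite fixed set, locally finite tree, `c` a type function and every MOVED vertex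
`v` of valency `q (c v) + 1` (for `U(1,1)_w`: `q = (q_v, q_v)`).  For every `n`: `O_γ^{ν∕ρ}(1_{K₀ t^{2n+1} K₀}) = ν(K₀) · (q 1 · q 0)ⁿ · #{x : d(x, γx) = 2 ∧ c x = 0}` — §4 with ★ W8-f
`ncard_displaced_inter_type_eq_of_odd`. [cite: Rogawski1990, §4.9 pp. 54–55] [cite: LabesseLanglands1979, §§2–3] [cite: Serre1980Trees, I.2.3, I.6.4 Prop. 24] -/
theorem orbitalIntegral_doubleCosetShell_odd_eq_two
    (hloc : ∀ v, ((latticeTree σ ϖ ((StdForm.antidiagonal 2).over K)).neighborSet v).Finite)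
    {u : {M : Submodule 𝒪[K] (Fin 2 → K) // IsSpecialLattice σ ϖ ((StdForm.antidiagonal 2).over K) M}}
    (hu : latticeTreeIso σ ϖ ((StdForm.antidiagonal 2).over K) γ u = u)
    (hfix : {v | latticeTreeIso σ ϖ ((StdForm.antidiagonal 2).over K) γ v = v}.Finite)
    (c : {M : Submodule 𝒪[K] (Fin 2 → K) // IsSpecialLattice σ ϖ ((StdForm.antidiagonal 2).over K) M} → Fin 2)
    (hc0 : ∀ v, c v = 0 ↔ IsSelfDualLattice σ ((StdForm.antidiagonal 2).over K) v.1) (q : Fin 2 → ℕ)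
    (hdeg : ∀ v, latticeTreeIso σ ϖ ((StdForm.antidiagonal 2).over K) γ v ≠ v →
      ((latticeTree σ ϖ ((StdForm.antidiagonal 2).over K)).neighborSet v).ncard = q (c v) + 1) (n : ℕ) :
    orbitalIntegral γ
        ((DoubleCoset.doubleCoset (t ^ (2 * n + 1)) (HermitianLattice.unitaryInt σ ((StdForm.antidiagonal 2).over K) : Set _)
            (HermitianLattice.unitaryInt σ ((StdForm.antidiagonal 2).over K))).indicator
          (1 : unitaryGroupOfForm σ ((StdForm.antidiagonal 2).over K) → ℝ))
        (quotientMeasure (Subgroup.centralizer ({γ} : Set (unitaryGroupOfForm σ ((StdForm.antidiagonal 2).over K)))) ρ hC ν) =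
      (ν (HermitianLattice.unitaryInt σ ((StdForm.antidiagonal 2).over K))).toReal *
        (((q 1 * q 0) ^ n *
            {x | (latticeTree σ ϖ ((StdForm.antidiagonal 2).over K)).dist x (latticeTreeIso σ ϖ ((StdForm.antidiagonal 2).over K) γ x) = 2 ∧
              c x = 0}.ncard : ℕ) : ℝ) := by
  classical
  haveI := isDiscreteValuationRing_integer_of_compatible hd.vϖ
  have hT := isTree_latticeTree σ (valuation_map_eq_of_datum hd) (isUniformizingElement_of_v_eq hd.vϖ) (isUnimodular₂_antidiagonal_two (K := K))
  haveI : (latticeTree σ ϖ ((StdForm.antidiagonal 2).over K)).LocallyFinite := fun v => (hloc v).fintype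
  have hdeg' : ∀ v, latticeTreeIso σ ϖ ((StdForm.antidiagonal 2).over K) γ v ≠ v →
      (latticeTree σ ϖ ((StdForm.antidiagonal 2).over K)).degree v = q (c v) + 1 := fun v hv => by
    rw [TreeDisplacement.degree_eq_ncard_neighborSet]; exact hdeg v hv
  rw [orbitalIntegral_doubleCosetShell_eq_mul_ncard_displaced_of_finite_fixedPoints_two hd t ht hA γ ρ ν hρ hloc hu hfix (2 * n + 1),
    setOf_selfDual_displaced_eq_setOf_displaced_type_zero_two γ c hc0,
    ncard_displaced_inter_type_eq_of_odd hT (latticeTreeIso σ ϖ ((StdForm.antidiagonal 2).over K) γ) hu hfix c (typeFun_ne_of_adj_two hd c hc0) q hdeg'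
      Fin.zero_ne_one n]

/-- **CLOSED FORM, EVEN POSITIVE INDEX (rank one)**: same hypotheses; for every `n`, `O_γ^{ν∕ρ}(1_{K₀ t^{2n+2} K₀}) = ν(K₀) · q 1 · (q 0 · q 1)ⁿ · #{x : d(x, γx) = 2 ∧ c x = 1}` — §4 with
★ W8-f `ncard_displaced_inter_type_eq_of_even` (the hyperspecial shells at even distance from `Fix γ` descend to the `ϖ`-MODULAR first shell).
[cite: Rogawski1990, §4.9 pp. 54–55] [cite: LabesseLanglands1979, §§2–3] [cite: Serre1980Trees, I.2.3, I.6.4 Prop. 24] -/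
theorem orbitalIntegral_doubleCosetShell_even_eq_two
    (hloc : ∀ v, ((latticeTree σ ϖ ((StdForm.antidiagonal 2).over K)).neighborSet v).Finite)
    {u : {M : Submodule 𝒪[K] (Fin 2 → K) // IsSpecialLattice σ ϖ ((StdForm.antidiagonal 2).over K) M}}
    (hu : latticeTreeIso σ ϖ ((StdForm.antidiagonal 2).over K) γ u = u)
    (hfix : {v | latticeTreeIso σ ϖ ((StdForm.antidiagonal 2).over K) γ v = v}.Finite)
    (c : {M : Submodule 𝒪[K] (Fin 2 → K) // IsSpecialLattice σ ϖ ((StdForm.antidiagonal 2).over K) M} → Fin 2)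
    (hc0 : ∀ v, c v = 0 ↔ IsSelfDualLattice σ ((StdForm.antidiagonal 2).over K) v.1) (q : Fin 2 → ℕ)
    (hdeg : ∀ v, latticeTreeIso σ ϖ ((StdForm.antidiagonal 2).over K) γ v ≠ v →
      ((latticeTree σ ϖ ((StdForm.antidiagonal 2).over K)).neighborSet v).ncard = q (c v) + 1) (n : ℕ) :
    orbitalIntegral γ
        ((DoubleCoset.doubleCoset (t ^ (2 * n + 2)) (HermitianLattice.unitaryInt σ ((StdForm.antidiagonal 2).over K) : Set _)
            (HermitianLattice.unitaryInt σ ((StdForm.antidiagonal 2).over K))).indicator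
          (1 : unitaryGroupOfForm σ ((StdForm.antidiagonal 2).over K) → ℝ))
        (quotientMeasure (Subgroup.centralizer ({γ} : Set (unitaryGroupOfForm σ ((StdForm.antidiagonal 2).over K)))) ρ hC ν) =
      (ν (HermitianLattice.unitaryInt σ ((StdForm.antidiagonal 2).over K))).toReal *
        ((q 1 * (q 0 * q 1) ^ n *
            {x | (latticeTree σ ϖ ((StdForm.antidiagonal 2).over K)).dist x (latticeTreeIso σ ϖ ((StdForm.antidiagonal 2).over K) γ x) = 2 ∧
              c x = 1}.ncard : ℕ) : ℝ) := by
  classical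
  haveI := isDiscreteValuationRing_integer_of_compatible hd.vϖ
  have hT := isTree_latticeTree σ (valuation_map_eq_of_datum hd) (isUniformizingElement_of_v_eq hd.vϖ) (isUnimodular₂_antidiagonal_two (K := K))
  haveI : (latticeTree σ ϖ ((StdForm.antidiagonal 2).over K)).LocallyFinite := fun v => (hloc v).fintype
  have hdeg' : ∀ v, latticeTreeIso σ ϖ ((StdForm.antidiagonal 2).over K) γ v ≠ v →
      (latticeTree σ ϖ ((StdForm.antidiagonal 2).over K)).degree v = q (c v) + 1 := fun v hv => by
    rw [TreeDisplacement.degree_eq_ncard_neighborSet]; exact hdeg v hv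
  rw [orbitalIntegral_doubleCosetShell_eq_mul_ncard_displaced_of_finite_fixedPoints_two hd t ht hA γ ρ ν hρ hloc hu hfix (2 * n + 2),
    setOf_selfDual_displaced_eq_setOf_displaced_type_zero_two γ c hc0,
    ncard_displaced_inter_type_eq_of_even hT (latticeTreeIso σ ϖ ((StdForm.antidiagonal 2).over K) γ) hu hfix c (typeFun_ne_of_adj_two hd c hc0) q hdeg'
      Fin.zero_ne_one n]

end Two

end Summit.HodgeConjecture.HodgeConjecture.R90.S6

end
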